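import Summits.BirchSwinnertonDyer.Rank1Residual.P2.CongruentNumberOddAokiMonskySymbols
import Mathlib.LinearAlgebra.Matrix.BilinearForm
import Mathlib.LinearAlgebra.BilinearForm.Orthogonal
import HarnessLib

/-!
# Cell `bsd-monsky`: AOKI = MONSKY, THE ODD CLASSES — part 4, the dictionary (ii): Aoki's sets on an odd
# `n = p₁⋯p_k`, the `2`-adic essential condition through `λ₂`, and the radical of a Gram matrix as a
# `BilinForm` orthogonal (nothing arithmetic asserted)

HONEST FRAMING (cell `bsd-monsky`, run/shared/lean/pub/bsd-monsky/, README §1). This file asserts NO arithmetic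
fact and carries NO named-fact binder. For an odd square-free `n = p₁⋯p_k` (`p : Fin k → ℕ` injective, odd primes):
* §1 Aoki's sets (Aoki 1999 §2): `S = S₁ = {p_i}`, `T₁ = {p_i ≡ 1 (4)}`, `T = T₁` for `n ≡ 3 (mod 8)` and
  `T = T₁ ∪ {2}` for `n ≡ 7 (mod 8)`, `S₂ = {p_i ≡ 3 (4)}` in both cases, `|S| = k`, `|T₁| = #{ε = 0}`;
* §2 the `2`-adic essential condition: `rep n w` is odd, `λ₂(x) = 0 ⟺ x ≡ ±1 (mod 8)` for odd `x` (Serre's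
  `(2, x)_2 = χ₈(x)`), so for `n ≡ 3 (mod 8)` the printed condition `x ≡ ±1 (mod 8)` on `x = x_w` reads
  `λ₂(x_w) = Σ_x w_x λ₂(x) = 0` — a linear condition `Σ_i t_i w_i = 0` on the exponent vector;
* §3 the radical of a Gram matrix over all elements of a subspace (the kernel term of
  `AokiMonsky.rank_gram_add_finrank`) is `W ∩ W^⊥` for the bilinear form `Matrix.toBilin' G`, and `toBilin' G`
  is symmetric for a symmetric `G` — so the restriction lemmas of `…OddAokiMonskyRestrict.lean` apply.
The assembly of the odd theorem is OWED (HOME/proof/PROOF-B-AOKI-MONSKY.md §5).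

References: [Aoki1999] §2 pp. 79–81, Thm. 2.2 p. 81; [Serre1973] Ch. III §1.2 Thm. 1; [IrelandRosen1990] Ch. 5 §1.
-/

noncomputable section

open scoped Classical

open Matrix WeierstrassCurve Literature.NumberTheory.EllipticCurves
  Literature.NumberTheory.EllipticCurves.Aoki1999
  Literature.NumberTheory.EllipticCurves.HeathBrown1994
  Literature.NumberTheory.EllipticCurves.HeathBrown1994.Families
  Literature.NumberTheory.QuadraticForms

set_option autoImplicit false

namespace Summit.BirchSwinnertonDyer.Rank1Residual.P2.AokiMonsky

/-! ## §1 Aoki's sets on an odd `n = p₁⋯p_k` -/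

section OddSets

variable {k : ℕ} (p : Fin k → ℕ) (hp : ∀ i, (p i).Prime) (hodd : ∀ i, Odd (p i))
  (hinj : Function.Injective p)

include hp hinj in
/-- `S = {p₁, …, p_k}` for odd `n`. [cite: Aoki1999, §2 p. 80] -/
theorem sSet_prod : sSet (∏ i, p i) = Finset.univ.image p := by
  unfold sSet
  rw [prod_eq_prod_image p hinj, Nat.primeFactors_prod (by simpa using fun i => hp i)]

include hp hodd hinj in
/-- `S₁ = S` for odd `n`. [cite: Aoki1999, §2 p. 80, Thm. 6.1 p. 93] -/
theorem sOneSet_prod : sOneSet (∏ i, p i) = Finset.univ.image p := by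
  unfold sOneSet
  rw [sSet_prod p hp hinj, Finset.filter_true_of_mem]
  intro x hx
  obtain ⟨i, -, rfl⟩ := Finset.mem_image.mp hx
  exact prime_ne_two p hodd i

include hp hinj in
/-- `T₁ = {p_i ≡ 1 (mod 4)}`. [cite: Aoki1999, §2 p. 80] -/
theorem tOneSet_prod : tOneSet (∏ i, p i) = (Finset.univ.filter fun i => p i % 4 = 1).image p := by
  unfold tOneSet
  rw [sSet_prod p hp hinj, Finset.filter_image]

include hp hinj in
/-- `T = T₁` for `n ≡ 3 (mod 8)`. [cite: Aoki1999, §2 p. 80] -/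
theorem tSet_prod_three (h3 : (∏ i, p i) % 8 = 3) :
    tSet (∏ i, p i) = (Finset.univ.filter fun i => p i % 4 = 1).image p := by
  unfold tSet
  rw [if_neg (by omega), tOneSet_prod p hp hinj]

include hp hinj in
/-- `T = T₁ ∪ {2}` for `n ≡ 7 (mod 8)`. [cite: Aoki1999, §2 p. 80] -/
theorem tSet_prod_seven (h7 : (∏ i, p i) % 8 = 7) :
    tSet (∏ i, p i) = insert 2 ((Finset.univ.filter fun i => p i % 4 = 1).image p) := by
  unfold tSet
  rw [if_pos (Or.inr h7), tOneSet_prod p hp hinj]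

include hp hodd hinj in
/-- `S₂ = S₁ ∖ T = {p_i ≡ 3 (mod 4)}` for `n ≡ 3 (mod 8)`. [cite: Aoki1999, Thm. 2.2 p. 81] -/
theorem sTwoSet_prod_three (h3 : (∏ i, p i) % 8 = 3) :
    sTwoSet (∏ i, p i) = (Finset.univ.filter fun i => ¬ p i % 4 = 1).image p := by
  unfold sTwoSet
  rw [sOneSet_prod p hp hodd hinj, tSet_prod_three p hp hinj h3, Finset.filter_not, Finset.image_sdiff _ _ hinj]

include hp hodd hinj in
/-- `S₂ = S₁ ∖ T = {p_i ≡ 3 (mod 4)}` for `n ≡ 7 (mod 8)` as well (`2 ∉ S₁`). [cite: Aoki1999, Thm. 2.2 p. 81] -/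
theorem sTwoSet_prod_seven (h7 : (∏ i, p i) % 8 = 7) :
    sTwoSet (∏ i, p i) = (Finset.univ.filter fun i => ¬ p i % 4 = 1).image p := by
  unfold sTwoSet
  rw [sOneSet_prod p hp hodd hinj, tSet_prod_seven p hp hinj h7, Finset.sdiff_insert_of_notMem,
    Finset.filter_not, Finset.image_sdiff _ _ hinj]
  intro h
  obtain ⟨i, -, hi⟩ := Finset.mem_image.mp h
  exact prime_ne_two p hodd i hi

include hp hinj in
/-- `|S| = k` for odd `n`. [cite: Aoki1999, §2 p. 80] -/
theorem card_sSet_prod : (sSet (∏ i, p i)).card = k := by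
  rw [sSet_prod p hp hinj, Finset.card_image_of_injective _ hinj, Finset.card_univ, Fintype.card_fin]

include hp hodd hinj in
/-- `|T| = #{ε = 0}` for `n ≡ 3 (mod 8)`. [cite: Aoki1999, §2 p. 80] -/
theorem card_tSet_prod_three (h3 : (∏ i, p i) % 8 = 3) :
    (tSet (∏ i, p i)).card = Fintype.card {i : Fin k // addLegendreSym (-1) (p i) = 0} := by
  rw [tSet_prod_three p hp hinj h3, Finset.card_image_of_injective _ hinj, Fintype.card_subtype]
  congr 1
  ext i
  simp only [Finset.mem_filter, Finset.mem_univ, true_and, eps_eq_zero_iff p hodd i]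

end OddSets

/-! ## §2 The `2`-adic essential condition through `λ₂` -/

section Essential

variable {k : ℕ} (p : Fin k → ℕ) (hp : ∀ i, (p i).Prime) (hodd : ∀ i, Odd (p i))
  (hinj : Function.Injective p)

/-- `λ₂(x) = 0 ⟺ x ≡ ±1 (mod 8)` for an odd integer `x` (`(2, x)_2 = χ₈(x)`). [cite: Serre1973, Ch. III §1.2 Thm. 1] -/
theorem lam_two_eq_zero_iff_mod_eight (n : ℕ) {x : ℤ} (hx : ¬ (2 : ℤ) ∣ x) :
    lam n 2 x = 0 ↔ (x % 8 = 1 ∨ x % 8 = 7) := by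
  have hx0 : x ≠ 0 := fun h => hx (h ▸ dvd_zero 2)
  rw [lam_two, hilbertBit_eq_zero_iff two_ne_zero hx0, localSign_two_two_left rfl hx,
    ZMod.χ₈_int_eq_if_mod_eight, if_neg (fun h => hx (Int.dvd_of_emod_eq_zero h))]
  constructor
  · intro h
    by_contra h'
    rw [if_neg h'] at h
    exact absurd h (by decide)
  · intro h
    rw [if_pos h]

include hp hodd hinj in
/-- `x_w = rep n w` is odd for odd `n` (a product of powers of the odd primes `p_i`). [cite: Aoki1999, §2 p. 80] -/
theorem not_two_dvd_rep_prod (w : ↥(sOneSet (∏ i, p i)) → ZMod 2) : ¬ (2 : ℤ) ∣ rep (∏ i, p i) w := by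
  intro h
  unfold rep at h
  obtain ⟨⟨x, hx1⟩, -, hx⟩ := (Prime.dvd_finsetProd_iff Int.prime_two _).mp h
  have h2x : (2 : ℤ) ∣ (x : ℕ) := Int.prime_two.dvd_of_dvd_pow hx
  rw [sOneSet_prod p hp hodd hinj] at hx1
  obtain ⟨i, -, hi⟩ := Finset.mem_image.mp hx1
  rw [← hi] at h2x
  have h2x' : 2 ∣ p i := by exact_mod_cast h2x
  exact (Nat.not_even_iff_odd.mpr (hodd i)) (even_iff_two_dvd.mpr h2x')

include hp hodd hinj in
/-- **For `n ≡ 3 (mod 8)` the printed `2`-adic condition `x_w ≡ ±1 (mod 8)` is the linear condition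
`λ₂(x_w) = Σ_x w_x λ₂(x) = 0`** on the exponent vector. [cite: Aoki1999, §2 p. 80] -/
theorem essentialCond_prod_three_iff (h3 : (∏ i, p i) % 8 = 3) (w : ↥(sOneSet (∏ i, p i)) → ZMod 2) :
    essentialCond (∏ i, p i) (rep (∏ i, p i) w) ↔
      ∑ x : ↥(sOneSet (∏ i, p i)), w x * lam (∏ i, p i) 2 ((x : ℕ) : ℤ) = 0 := by
  have hn0 : (∏ i, p i) ≠ 0 := Finset.prod_ne_zero_iff.mpr fun i _ => (hp i).ne_zero
  unfold essentialCond
  rw [if_neg (by omega), if_pos (Or.inl h3), ← lam_rep hn0,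
    lam_two_eq_zero_iff_mod_eight _ (not_two_dvd_rep_prod p hp hodd hinj w)]

end Essential

/-! ## §3 The radical of a Gram matrix over a subspace is `W ∩ W^⊥` for `Matrix.toBilin' G` -/

section Radical

variable {K : Type*} [Field K] {ι : Type*} [Fintype ι] [DecidableEq ι]

/-- The kernel term of `rank_gram_add_finrank` is the `BilinForm` radical `W ⊓ W^⊥` of `Matrix.toBilin' G` on `W`.
[folklore] -/
theorem inf_ker_gram_eq_inf_orthogonal (G : Matrix ι ι K) (Wfin : Finset (ι → K)) (W : Submodule K (ι → K))
    (hW : ∀ u, u ∈ Wfin ↔ u ∈ W) :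
    W ⊓ LinearMap.ker (Matrix.of fun (w : ↥Wfin) (i : ι) => ((w : ι → K) ᵥ* G) i).mulVecLin =
      W ⊓ (Matrix.toBilin' G).orthogonal W := by
  ext u
  simp only [Submodule.mem_inf, LinearMap.mem_ker, Matrix.mulVecLin_apply,
    LinearMap.BilinForm.mem_orthogonal_iff, Matrix.toBilin'_apply']
  refine and_congr_right fun _ => ?_
  constructor
  · intro h n hn
    have := congr_fun h ⟨n, (hW n).mpr hn⟩
    rw [Pi.zero_apply] at this
    rw [Matrix.dotProduct_mulVec]
    exact this
  · intro h
    ext w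
    rw [Pi.zero_apply]
    have := h (w : ι → K) ((hW _).mp w.2)
    rw [Matrix.dotProduct_mulVec] at this
    exact this

/-- `Matrix.toBilin' G` is symmetric for a symmetric matrix. [folklore] -/
theorem isSymm_toBilin'_of_symm (G : Matrix ι ι K) (hG : ∀ i j, G i j = G j i) :
    (Matrix.toBilin' G).IsSymm := by
  have hT : Gᵀ = G := by ext i j; exact hG j i
  refine LinearMap.BilinForm.isSymm_def.mpr fun x y => ?_
  rw [Matrix.toBilin'_apply', Matrix.toBilin'_apply', Matrix.dotProduct_mulVec, ← Matrix.mulVec_transpose, hT,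
    dotProduct_comm]

end Radical

end Summit.BirchSwinnertonDyer.Rank1Residual.P2.AokiMonsky

end
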